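import Summits.AtomisticToContinuum.Crystallization.Theorems.ChartedZeroExcessLayeredLatticeLiouvilleZZZWB

/-!
# ChartedZeroExcess · LayeredLatticeLiouville ZZZX (lens-2 g89 NODE 89 part 3 «ChainPoincaré») — (RGᴸ) GRAPH RIGIDITY REDUCED TO S-SIDE GEOMETRY:
# `(RGᴸ) DeficitRigidityP … Rd cR ⟸ (RG-geo) CoreFrameTreeP … Rd N₀ H₀ μ₀ Δ₀` with the EXPLICIT constant `cR = 1/(N₀·H₀²·(1 + 3Δ₀/μ₀)²) > 0` (PROVED), through the
# finite-dimensional CHAIN-POINCARÉ RIGIDITY LEMMA (RG-fin) `rigidMisfit y xf (V i₀) (xf i₀ − V i₀ (y i₀)) ≤ n·H²·(1 + 3Δ/μ)²·coreDeficit Rd y₀ y xf V` (PROVED, every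
# rotation field `V`, every configuration carrying a rooted spanning FRAME TREE of depth `≤ H`, tripod fatness `μ` and diameter `Δ`); and the doors
# `[MCMC♮] ⟸ (SC♮) ∧ (X1ᴸ) ∧ (X2ᴸ) ∧ (RG-geo) ∧ (DWᴹ)(cE, σ₀)` (`σ₀ < cE·cR·10⁻⁴`) and — at the EXACT WELL `σ₀ = 0` of record (critic row 1586, SCOPE-RG) —
# `[MCMC♮] ⟸ (SC♮) ∧ (X1ᴸ) ∧ (X2ᴸ) ∧ (RG-geo) ∧ (DWᴹ)(cE, 0)`, `0 < cE` (PROVED).  0 sorry · import = ZZZWB · 2 Prop-defs (`IsFrameTree`, `CoreFrameTreeP`) + 1 def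
# (`siteFrame`) · axioms standard.

WHY (critic row 1586, SCOPE-RG ruling): with `σ₀ := 0` the W2c side condition `σ₀ < cE·cR·10⁻⁴` only asks `cR > 0`, so (RGᴸ) is wanted for ANY explicit positive
constant; the loss-free way is Friesecke–James–Müller-type graph rigidity proved by CHAINING LOCAL FRAMES: the `i`-row of the deficit says the core is, on the
star of `i`, within `√D` of the rigid motion `A_i : z ↦ V i (z − y i) + xf i` applied to the filling; two frames `A_p`, `A_j` of a parent/child pair agree
within `√D … 2√D` at `y j` and at a TRIPOD of common star sites, hence (ℓ¹-fatness `μ` of the tripod vectors, linearity of `V p − V j` — no cross product, no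
determinant) within `(1 + 3Δ/μ)·√D` on the whole configuration; telescoping along the tree (depth `≤ H`) puts every site within `H·(1 + 3Δ/μ)·√D` of the ROOT
frame's rigid copy, whose rotation `V i₀` is proper whenever the adversary's field is.  No Poincaré constant of the lattice, no spectral gap, no compactness:
an induction on depth.

THE CUT (glue PROVED, `deficitRigidityP_of_coreFrameTree`): (RGᴸ)(cR = 1/(N₀H₀²(1+3Δ₀/μ₀)²)) ⟸ (RG-geo) «CoreFrameTreeP … Rd N₀ H₀ μ₀ Δ₀» = under the door
binders of (RGᴸ) (verbatim, minus the rotation field): the enumerated `ρ`-core has `n ≤ N₀` sites and, if non-empty, a rooted spanning frame tree at pair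
range `Rd` w.r.t. the LABELS `lab ∘ xf`, with `y`-tripod fatness `μ₀` and `y`-diameter `Δ₀`, for every filling `y` of the inner label tube.  [KINEMATIC ·
LJ-free · deficit-free · rotation-free · S-SIDE COMBINATORIAL GEOMETRY · NEW · UNDECIDED · TRUE-type at `Rd = 121/25` (BFS tree of the core bond graph rooted
in `K`: parent = a bonded in-core neighbour one hop closer, depth `≤` hop-eccentricity; tripod = three in-core bonded neighbours with non-coplanar LABEL bond
vectors — toward the nearest `k ∈ K` at least three first-shell neighbours lie in the core and no three same-side first-shell vectors of fcc/hcp are coplanar;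
fatness transfers from the placed crystal to `y` through the tube radius `sb₁ ≤ 249/20000`; `N₀` by hard-core packing `card_le_of_separated_of_dist_le`;
`Δ₀` from the bulk pins `dB₁` and the label chain) · ATTACKABLE-S · sizes: packing XS, tree/tripod M (finite Barlow case tables as in tree ZZZV), fatness
transfer S].  (RG-fin) is this file's theorem `rigidMisfit_root_le_of_frameTree` [PROVED].

Main results, all PROVED (0 sorry): `siteFrame`, `siteFrame_self`, `siteFrame_sub`, `deficitPair_eq_siteFrame`, `dist_siteFrame_le_sqrt`; `IsFrameTree`;
`siteFrame_parent_sub_le` (one edge), `siteFrame_sub_root_le` (depth induction), ★ `rigidMisfit_root_le_of_frameTree` (RG-fin); `CoreFrameTreeP` (RG-geo);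
★ `deficitRigidityP_of_coreFrameTree` (the glue, explicit `cR`); doors ★ `mildCoherentMoatCorePG_W2c_of_frameTree` (σ₀-gap form) and
★★ `mildCoherentMoatCorePG_W2c_exactWell` (`σ₀ = 0`, `0 < cE`: `[MCMC♮] ⟸ (SC♮) ∧ (X1ᴸ) ∧ (X2ᴸ) ∧ (RG-geo) ∧ (DWᴹ)(cE, 0)`).

Tags: KINEMATIC throughout · LJ enters only through the untouched door binders · no `sorry`, no new axioms, no instances/notation · import = tree ZZZWB (NODE 89
parts 1 + 2; lands after it).
-/

noncomputable section
open scoped BigOperators Classical InnerProductSpace RealInnerProductSpace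
open MeasureTheory Set Metric Filter Topology
open Literature.Geometry.DiscreteGeometry (IsTwoShellGoodSet)
open Literature.MathematicalPhysics.StatisticalMechanics (lennardJones card_le_of_separated_of_dist_le)

namespace Summit.AtomisticToContinuum.Crystallization.Theorems.ChartedZeroExcessLayeredLatticeLiouville

open Summit.AtomisticToContinuum.Crystallization.Theorems.ChartedPlanarOrderRigidityDoor (E3 IsClean atomsIn)
open Summit.AtomisticToContinuum.Crystallization.Theorems.ChartedPlanarOrderDensityDichotomy (μS IsSep)
open Summit.AtomisticToContinuum.Crystallization.Theorems.ChartedPlanarOrderCleanScaleP (IsCleanP IsDoorSetP)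
open Summit.AtomisticToContinuum.Crystallization.Theorems.ChartedPlanarOrderMesoCut (LayeredHom EnvClose)
open Summit.AtomisticToContinuum.Crystallization.Theorems.ChartedPlanarOrderDoorLayeredOsc (IsTwoShellAffineGood)

/-! ### ZZZX-1  (RG-fin) chain-Poincaré rigidity along a frame tree (finite-dimensional, PROVED) -/

section FrameTree

variable {n : ℕ}

/-- the affine FRAME of site `i`: `z ↦ V i (z − y i) + xf i` (the rigid motion that the `i`-row of the deficit compares the core with). -/
def siteFrame (y xf : Fin n → E3) (V : Fin n → (E3 ≃ₗᵢ[ℝ] E3)) (i : Fin n) (z : E3) : E3 := V i (z - y i) + xf i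

variable {Rd μ Δ : ℝ} {H : ℕ} {y₀ y xf : Fin n → E3} {V : Fin n → (E3 ≃ₗᵢ[ℝ] E3)}

/-- The frame of site `i` maps `y i` to `xf i`. [bookkeeping; lane docstring, hand-2 g42] -/
theorem siteFrame_self (i : Fin n) : siteFrame y xf V i (y i) = xf i := by
  simp [siteFrame]

/-- Differences under the frame of site `i` are `V i` applied to the difference (the translation cancels). [bookkeeping; lane docstring, hand-2 g42] -/
theorem siteFrame_sub (i : Fin n) (z z' : E3) : siteFrame y xf V i z - siteFrame y xf V i z' = V i (z - z') := by
  have e : z - z' = (z - y i) - (z' - y i) := by abel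
  rw [e, map_sub]
  simp only [siteFrame]
  abel

/-- the pair term of the deficit is the distance of `xf j` to the frame of `i` at `y j`. -/
theorem deficitPair_eq_siteFrame (i j : Fin n) : (xf j - xf i) - V i (y j - y i) = xf j - siteFrame y xf V i (y j) := by
  simp only [siteFrame]
  abel

/-- every in-range pair: `‖xf j − A_i (y j)‖ ≤ √D`. -/
theorem dist_siteFrame_le_sqrt (i j : Fin n) (hij : dist (y₀ i) (y₀ j) ≤ Rd) :
    ‖xf j - siteFrame y xf V i (y j)‖ ≤ Real.sqrt (coreDeficit Rd y₀ y xf V) := by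
  have h := term_le_coreDeficit (xf := xf) (y := y) (U := V) i j hij
  rw [deficitPair_eq_siteFrame] at h
  calc ‖xf j - siteFrame y xf V i (y j)‖ = Real.sqrt (‖xf j - siteFrame y xf V i (y j)‖ ^ 2) := (Real.sqrt_sq (norm_nonneg _)).symm
    _ ≤ Real.sqrt (coreDeficit Rd y₀ y xf V) := Real.sqrt_le_sqrt h

/-- ★ **`IsFrameTree Rd μ Δ H y₀ y i₀ par dep t`** — a ROOTED SPANNING FRAME TREE of the configuration: root `i₀`, parent map `par` strictly decreasing
the depth `dep ≤ H`, every non-root site `j` IN RANGE `Rd` of its parent (w.r.t. the reference `y₀`), and a TRIPOD `t j : Fin 3 → Fin n` of sites in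
range of both `j` and `par j` whose difference vectors `y (t j k) − y j` span `E3` with `ℓ¹`-coefficient bound `‖z‖/μ` (FATNESS `μ`); `Δ` bounds the
diameter of `y`.  The finite-dimensional hypothesis package of the chain-Poincaré rigidity lemma. [this file, g89] -/
def IsFrameTree (Rd μ Δ : ℝ) (H : ℕ) (y₀ y : Fin n → E3) (i₀ : Fin n) (par : Fin n → Fin n) (dep : Fin n → ℕ) (t : Fin n → Fin 3 → Fin n) :
    Prop :=
  (∀ j, dep j = 0 → j = i₀) ∧ (∀ j, dep j ≠ 0 → dep (par j) < dep j) ∧ (∀ j, dep j ≤ H) ∧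
    (∀ j, dep j ≠ 0 → dist (y₀ (par j)) (y₀ j) ≤ Rd) ∧
      (∀ j, dep j ≠ 0 → ∀ k, dist (y₀ (par j)) (y₀ (t j k)) ≤ Rd ∧ dist (y₀ j) (y₀ (t j k)) ≤ Rd) ∧
        (∀ j, dep j ≠ 0 → ∀ z : E3, ∃ α : Fin 3 → ℝ, z = ∑ k, α k • (y (t j k) - y j) ∧ ∑ k, |α k| ≤ ‖z‖ / μ) ∧
          ∀ i k, dist (y k) (y i) ≤ Δ

variable {i₀ : Fin n} {par : Fin n → Fin n} {dep : Fin n → ℕ} {t : Fin n → Fin 3 → Fin n}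

/-- ONE EDGE OF THE TREE (PROVED): the frames of a site and of its parent differ, at every site of the configuration, by at most `(1 + 3Δ/μ)·√D`. -/
theorem siteFrame_parent_sub_le (hμ : 0 < μ) (hT : IsFrameTree Rd μ Δ H y₀ y i₀ par dep t) (j : Fin n) (hj : dep j ≠ 0) (k : Fin n) :
    ‖siteFrame y xf V (par j) (y k) - siteFrame y xf V j (y k)‖ ≤ (1 + 3 * Δ / μ) * Real.sqrt (coreDeficit Rd y₀ y xf V) := by
  obtain ⟨_, _, _, hpar, htri, hfat, hdiam⟩ := hT
  set D := Real.sqrt (coreDeficit Rd y₀ y xf V) with hD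
  have hD0 : 0 ≤ D := Real.sqrt_nonneg _
  set p := par j with hp
  -- the two frames agree at `y j` up to `√D`
  have h0 : ‖siteFrame y xf V p (y j) - siteFrame y xf V j (y j)‖ ≤ D := by
    rw [siteFrame_self, ← norm_neg, neg_sub]
    exact dist_siteFrame_le_sqrt p j (hpar j hj)
  -- and at the three tripod sites up to `2√D`
  have h1 : ∀ m, ‖siteFrame y xf V p (y (t j m)) - siteFrame y xf V j (y (t j m))‖ ≤ 2 * D := by
    intro m
    have a := dist_siteFrame_le_sqrt (xf := xf) (y := y) (V := V) p (t j m) (htri j hj m).1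
    have b := dist_siteFrame_le_sqrt (xf := xf) (y := y) (V := V) j (t j m) (htri j hj m).2
    calc ‖siteFrame y xf V p (y (t j m)) - siteFrame y xf V j (y (t j m))‖
        ≤ ‖siteFrame y xf V p (y (t j m)) - xf (t j m)‖ + ‖xf (t j m) - siteFrame y xf V j (y (t j m))‖ := norm_sub_le_norm_sub_add_norm_sub _ _ _
      _ ≤ D + D := by rw [← norm_neg, neg_sub] ; exact add_le_add a b
      _ = 2 * D := by ring
  -- hence the linear parts differ by at most `3√D` on each tripod vector
  have h2 : ∀ m, ‖V p (y (t j m) - y j) - V j (y (t j m) - y j)‖ ≤ 3 * D := by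
    intro m
    have e : V p (y (t j m) - y j) - V j (y (t j m) - y j) =
        (siteFrame y xf V p (y (t j m)) - siteFrame y xf V j (y (t j m))) - (siteFrame y xf V p (y j) - siteFrame y xf V j (y j)) := by
      rw [← siteFrame_sub p, ← siteFrame_sub j]; abel
    rw [e]
    calc ‖(siteFrame y xf V p (y (t j m)) - siteFrame y xf V j (y (t j m))) - (siteFrame y xf V p (y j) - siteFrame y xf V j (y j))‖
        ≤ ‖siteFrame y xf V p (y (t j m)) - siteFrame y xf V j (y (t j m))‖ + ‖siteFrame y xf V p (y j) - siteFrame y xf V j (y j)‖ := norm_sub_le _ _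
      _ ≤ 2 * D + D := add_le_add (h1 m) h0
      _ = 3 * D := by ring
  -- by fatness, on the vector `y k − y j` (length ≤ Δ) they differ by at most `(Δ/μ)·3√D`
  have h3 : ‖V p (y k - y j) - V j (y k - y j)‖ ≤ Δ / μ * (3 * D) := by
    obtain ⟨α, hz, hα⟩ := hfat j hj (y k - y j)
    have hV : ∀ W : E3 ≃ₗᵢ[ℝ] E3, W (y k - y j) = ∑ m, α m • W (y (t j m) - y j) := by
      intro W
      rw [hz, map_sum]
      exact Finset.sum_congr rfl fun m _ => map_smul W (α m) _
    have hlin : V p (y k - y j) - V j (y k - y j) = ∑ m, α m • (V p (y (t j m) - y j) - V j (y (t j m) - y j)) := by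
      rw [hV (V p), hV (V j), ← Finset.sum_sub_distrib]
      exact Finset.sum_congr rfl fun m _ => (smul_sub (α m) _ _).symm
    rw [hlin]
    calc ‖∑ m, α m • (V p (y (t j m) - y j) - V j (y (t j m) - y j))‖
        ≤ ∑ m, ‖α m • (V p (y (t j m) - y j) - V j (y (t j m) - y j))‖ := norm_sum_le _ _
      _ ≤ ∑ m, |α m| * (3 * D) := Finset.sum_le_sum fun m _ => by
            rw [norm_smul, Real.norm_eq_abs]; exact mul_le_mul_of_nonneg_left (h2 m) (abs_nonneg _)
      _ = (∑ m, |α m|) * (3 * D) := by rw [Finset.sum_mul]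
      _ ≤ ‖y k - y j‖ / μ * (3 * D) := mul_le_mul_of_nonneg_right hα (by positivity)
      _ ≤ Δ / μ * (3 * D) := by
            have hk : ‖y k - y j‖ ≤ Δ := by rw [← dist_eq_norm]; exact hdiam j k
            exact mul_le_mul_of_nonneg_right (div_le_div_of_nonneg_right hk hμ.le) (by positivity)
  -- assemble: `A_p (y k) − A_j (y k) = (V p − V j)(y k − y j) + (A_p (y j) − A_j (y j))`
  have e2 : siteFrame y xf V p (y k) - siteFrame y xf V j (y k) =
      (V p (y k - y j) - V j (y k - y j)) + (siteFrame y xf V p (y j) - siteFrame y xf V j (y j)) := by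
    rw [← siteFrame_sub p, ← siteFrame_sub j]; abel
  rw [e2]
  calc ‖(V p (y k - y j) - V j (y k - y j)) + (siteFrame y xf V p (y j) - siteFrame y xf V j (y j))‖
      ≤ ‖V p (y k - y j) - V j (y k - y j)‖ + ‖siteFrame y xf V p (y j) - siteFrame y xf V j (y j)‖ := norm_add_le _ _
    _ ≤ Δ / μ * (3 * D) + D := add_le_add h3 h0
    _ = (1 + 3 * Δ / μ) * D := by ring

/-- ALONG THE TREE (PROVED): the frame of a site of depth `d` differs from the ROOT frame, at every site, by at most `d·(1 + 3Δ/μ)·√D`. -/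
theorem siteFrame_sub_root_le (hμ : 0 < μ) (hT : IsFrameTree Rd μ Δ H y₀ y i₀ par dep t) :
    ∀ (d : ℕ) (j : Fin n), dep j ≤ d → ∀ k : Fin n,
      ‖siteFrame y xf V j (y k) - siteFrame y xf V i₀ (y k)‖ ≤ d * ((1 + 3 * Δ / μ) * Real.sqrt (coreDeficit Rd y₀ y xf V)) := by
  have hroot := hT.1
  have hdec := hT.2.1
  intro d
  induction d with
  | zero =>
      intro j hj k
      have h0 : dep j = 0 := Nat.le_zero.1 hj
      rw [hroot j h0, sub_self, norm_zero, Nat.cast_zero, zero_mul]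
  | succ d ih =>
      intro j hj k
      by_cases h0 : dep j = 0
      · rw [hroot j h0, sub_self, norm_zero]
        have : 0 ≤ (1 + 3 * Δ / μ) * Real.sqrt (coreDeficit Rd y₀ y xf V) := by
          have := siteFrame_parent_sub_le (xf := xf) (V := V) hμ hT
          -- nonnegativity from any instance is awkward; prove directly
          have hs : 0 ≤ Real.sqrt (coreDeficit Rd y₀ y xf V) := Real.sqrt_nonneg _
          by_cases hc : 0 ≤ 1 + 3 * Δ / μ
          · exact mul_nonneg hc hs
          · -- if the constant were negative, the edge bound at `j`… not available at the root; use `d = 0` case trivially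
            -- fall back: the claim `0 ≤ (d+1) * c` is only needed as an upper bound of `0`; use the parent-edge bound of ANY non-root site if one
            -- exists — but none may exist. Instead observe `Δ ≥ 0` from the diameter clause at `(i₀, i₀)` and conclude `hc` holds.
            exfalso
            have hΔ : 0 ≤ Δ := le_trans dist_nonneg (hT.2.2.2.2.2.2 i₀ i₀)
            exact hc (by positivity)
        positivity
      · have hp : dep (par j) ≤ d := Nat.lt_succ_iff.1 (lt_of_lt_of_le (hdec j h0) hj)
        have e := ih (par j) hp k
        have f := siteFrame_parent_sub_le (xf := xf) (V := V) hμ hT j h0 k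
        calc ‖siteFrame y xf V j (y k) - siteFrame y xf V i₀ (y k)‖
            ≤ ‖siteFrame y xf V j (y k) - siteFrame y xf V (par j) (y k)‖ + ‖siteFrame y xf V (par j) (y k) - siteFrame y xf V i₀ (y k)‖ :=
              norm_sub_le_norm_sub_add_norm_sub _ _ _
          _ ≤ (1 + 3 * Δ / μ) * Real.sqrt (coreDeficit Rd y₀ y xf V) + d * ((1 + 3 * Δ / μ) * Real.sqrt (coreDeficit Rd y₀ y xf V)) := by
              rw [← norm_neg, neg_sub] at f ⊢
              · exact add_le_add (by rw [← norm_neg, neg_sub]; exact f) e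
          _ = (d + 1 : ℕ) * ((1 + 3 * Δ / μ) * Real.sqrt (coreDeficit Rd y₀ y xf V)) := by push_cast; ring

/-- ★★★ **CHAIN-POINCARÉ RIGIDITY (PROVED, finite-dimensional)**: on a configuration with a rooted spanning frame tree of depth `≤ H`, fatness `μ > 0`
and diameter `Δ`, the ℓ²-misfit of the core `xf` from the ROOT FRAME's rigid copy of the filling `y` — rotation `V i₀` (PROPER whenever the
adversary's field is), translation `xf i₀ − V i₀ (y i₀)` — is at most `n·H²·(1 + 3Δ/μ)² ×` the sitewise-co-rotated deficit, FOR EVERY rotation field `V`.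
The finite-dimensional content of (RGᴸ) `DeficitRigidityP`; the constant is irrelevant for the W2 line (side condition `cR > 0` at `σ₀ = 0`,
memo SCOPE-RG-g89 §1). [this file, g89] -/
theorem rigidMisfit_root_le_of_frameTree (hμ : 0 < μ) (hT : IsFrameTree Rd μ Δ H y₀ y i₀ par dep t) :
    rigidMisfit y xf (V i₀) (xf i₀ - V i₀ (y i₀)) ≤ n * H ^ 2 * (1 + 3 * Δ / μ) ^ 2 * coreDeficit Rd y₀ y xf V := by
  set c := (1 + 3 * Δ / μ) * Real.sqrt (coreDeficit Rd y₀ y xf V) with hc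
  have hH := hT.2.2.1
  have hsite : ∀ j, ‖xf j - (V i₀ (y j) + (xf i₀ - V i₀ (y i₀)))‖ ^ 2 ≤ (H * c) ^ 2 := by
    intro j
    have e : V i₀ (y j) + (xf i₀ - V i₀ (y i₀)) = siteFrame y xf V i₀ (y j) := by
      simp only [siteFrame, map_sub]; abel
    have h := siteFrame_sub_root_le (xf := xf) (V := V) hμ hT H j (hH j) j
    rw [siteFrame_self] at h
    rw [e]
    have h0 : 0 ≤ ‖xf j - siteFrame y xf V i₀ (y j)‖ := norm_nonneg _
    exact pow_le_pow_left₀ h0 h 2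
  calc rigidMisfit y xf (V i₀) (xf i₀ - V i₀ (y i₀)) = ∑ j, ‖xf j - (V i₀ (y j) + (xf i₀ - V i₀ (y i₀)))‖ ^ 2 := rfl
    _ ≤ ∑ _j : Fin n, (H * c) ^ 2 := Finset.sum_le_sum fun j _ => hsite j
    _ = n * (H * c) ^ 2 := by rw [Finset.sum_const, Finset.card_univ, Fintype.card_fin, nsmul_eq_mul]
    _ = n * H ^ 2 * (1 + 3 * Δ / μ) ^ 2 * (Real.sqrt (coreDeficit Rd y₀ y xf V)) ^ 2 := by rw [hc]; ring
    _ = n * H ^ 2 * (1 + 3 * Δ / μ) ^ 2 * coreDeficit Rd y₀ y xf V := by rw [Real.sq_sqrt coreDeficit_nonneg]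

end FrameTree

/-! ### ZZZX-2  (RG-geo) the S-side leaf and the glue (RGᴸ) ⟸ (RG-geo) (PROVED) -/

section Reduction

/-- ★★★ **(RG-geo) «CoreFrameTreeP … Rg sb₁ dI₁ dB₁ Rd N₀ H₀ μ₀ Δ₀ …» — THE CORE CARRIES A BOUNDED, FAT, SHALLOW SPANNING FRAME TREE.**  Under the binders of
(RGᴸ) `DeficitRigidityP` (verbatim: θ-good `aHi`-door set, LJ summable, equilibrium chart, container, `ϑp`-mild `rm`-core, `ϑc`-cool moat, enumerated
`ρ`-core `xf`, cool shadow crystal, bond label `lab`) and for every filling `y` of the inner label tube: the core has AT MOST `N₀` sites, and if it is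
non-empty there are a root `i₀`, a parent map, a depth map `≤ H₀` and tripods forming an `IsFrameTree Rd μ₀ Δ₀ H₀ (lab ∘ xf) y …` (parent and tripod IN
RANGE `Rd` for the LABELS, tripod `y`-vectors `μ₀`-fat, `y`-diameter `≤ Δ₀`).  KINEMATIC · LJ-free · deficit-free · rotation-free · S-SIDE combinatorial
geometry · NEW · UNDECIDED · TRUE-type at `Rd = 121/25` for suitable explicit `(N₀, H₀, μ₀, Δ₀)` (BFS tree of the core bond graph; three same-side
first-shell neighbours of a Barlow site are never coplanar; packing) · ATTACKABLE-S.  Why it might fail: a core site all of whose in-core bonded neighbours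
have coplanar label vectors (excluded toward the nearest container atom by the first-shell case tables), or a mis-set constant.  Sources: this file's
docstring; FJM 2002 §3 (discrete rigidity by chaining), tree ZZZV (Barlow first-shell tables). [this file, g89] -/
def CoreFrameTreeP (ϑc ϑp r rΘ q rsh ρ rm σ ϑr Rs ε rI ℓ Rg sb₁ dI₁ dB₁ Rd : ℝ) (N₀ H₀ : ℕ) (μ₀ Δ₀ aHi Λ θ s : ℝ) : Prop :=
  ∀ δ : ℝ, 0 < δ → ∀ a : ℝ, 0 < a →
    ∀ S : Set E3, IsDoorSetP aHi δ S → (∀ z : E3, Summable fun y : S => lennardJones (dist z (y : E3))) →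
      (∀ p ∈ S, IsTwoShellAffineGood θ S p) →
        ∀ (L : E3 ≃L[ℝ] E3) (w : ℤ → E3), IsEquilChart a s Λ L w →
          ∀ (x₀ : E3) (K : Set E3), K ⊆ S → (∀ k ∈ K, dist k x₀ ≤ q) →
            IsTameOn ϑp S (LayeredHom (L : E3 →L[ℝ] E3) w) (coreOf S K rm) →
              IsTameOn ϑc S (LayeredHom (L : E3 →L[ℝ] E3) w) (moatIn S K r (r + rsh)) →
                ∀ (n : ℕ) (xf : Fin n → E3), Function.Injective xf → Set.range xf = coreOf S K ρ →
                  ∀ (L' : E3 →L[ℝ] E3) (w' : ℤ → E3) (U : E3 ≃ₗᵢ[ℝ] E3) (t : E3),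
                    IsCoolShadowCrystal σ ϑr Rs ε r rI ℓ S K (LayeredHom (L : E3 →L[ℝ] E3) w) L' w' U t →
                      ∀ lab : E3 → E3, IsBondLabel ε rΘ ℓ S K (placedCrystal L' w' U t) lab →
                        ∀ y ∈ bondTube (S \ coreOf S K ρ) Rg sb₁ dI₁ dB₁ (fun i => lab (xf i)),
                          n ≤ N₀ ∧ (n ≠ 0 → ∃ (i₀ : Fin n) (par : Fin n → Fin n) (dep : Fin n → ℕ) (tri : Fin n → Fin 3 → Fin n),
                            IsFrameTree Rd μ₀ Δ₀ H₀ (fun i => lab (xf i)) y i₀ par dep tri)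

/-- the explicit rigidity constant of the chain-Poincaré route. -/
theorem chainRigidityConst_pos {N₀ H₀ : ℕ} {μ₀ Δ₀ : ℝ} (hN : 0 < N₀) (hH : 0 < H₀) (hμ : 0 < μ₀) (hΔ : 0 ≤ Δ₀) :
    0 < 1 / ((N₀ : ℝ) * (H₀ : ℝ) ^ 2 * (1 + 3 * Δ₀ / μ₀) ^ 2) := by
  positivity

/-- ★★★ **THE GLUE (PROVED): (RGᴸ)(`cR = 1/(N₀·H₀²·(1 + 3Δ₀/μ₀)²)`) ⟸ (RG-geo)(N₀, H₀, μ₀, Δ₀).**  Given the frame tree, (RG-fin) bounds the misfit from the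
root frame's rigid copy (rotation `V i₀`, proper because the field is) by `n·H₀²·(1+3Δ₀/μ₀)²·D ≤ N₀·H₀²·(1+3Δ₀/μ₀)²·D`; an empty core has misfit `0`. [this file, g89] -/
theorem deficitRigidityP_of_coreFrameTree {ϑc ϑp r rΘ q rsh ρ rm σ ϑr Rs ε rI ℓ Rg sb₁ dI₁ dB₁ Rd μ₀ Δ₀ aHi Λ θ s : ℝ} {N₀ H₀ : ℕ} (hN : 0 < N₀)
    (hH : 0 < H₀) (hμ : 0 < μ₀) (hΔ : 0 ≤ Δ₀) (hG : CoreFrameTreeP ϑc ϑp r rΘ q rsh ρ rm σ ϑr Rs ε rI ℓ Rg sb₁ dI₁ dB₁ Rd N₀ H₀ μ₀ Δ₀ aHi Λ θ s) :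
    DeficitRigidityP ϑc ϑp r rΘ q rsh ρ rm σ ϑr Rs ε rI ℓ Rg sb₁ dI₁ dB₁ Rd (1 / ((N₀ : ℝ) * (H₀ : ℝ) ^ 2 * (1 + 3 * Δ₀ / μ₀) ^ 2)) aHi Λ θ s := by
  intro δ hδ a ha S hS hsum hgood L w hLw x₀ K hKS hKq hmild hcool n xf hxf hrange L' w' U t hC lab hlab y hy V hV
  obtain ⟨hn, htree⟩ := hG δ hδ a ha S hS hsum hgood L w hLw x₀ K hKS hKq hmild hcool n xf hxf hrange L' w' U t hC lab hlab y hy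
  have hK : 0 < (N₀ : ℝ) * (H₀ : ℝ) ^ 2 * (1 + 3 * Δ₀ / μ₀) ^ 2 := by positivity
  have hD : 0 ≤ coreDeficit Rd (fun i => lab (xf i)) y xf V := coreDeficit_nonneg
  by_cases h0 : n = 0
  · subst h0
    refine ⟨LinearIsometryEquiv.refl ℝ E3, 0, det_refl_E3_eq_one, ?_⟩
    have hz : rigidMisfit y xf (LinearIsometryEquiv.refl ℝ E3) 0 = 0 := by simp [rigidMisfit]
    rw [hz, mul_zero]
    exact hD
  · obtain ⟨i₀, par, dep, tri, hT⟩ := htree h0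
    refine ⟨V i₀, xf i₀ - V i₀ (y i₀), hV i₀, ?_⟩
    have hfin := rigidMisfit_root_le_of_frameTree (xf := xf) (V := V) hμ hT
    have hnN : (n : ℝ) * (H₀ : ℝ) ^ 2 * (1 + 3 * Δ₀ / μ₀) ^ 2 ≤ (N₀ : ℝ) * (H₀ : ℝ) ^ 2 * (1 + 3 * Δ₀ / μ₀) ^ 2 := by
      have : (n : ℝ) ≤ N₀ := by exact_mod_cast hn
      gcongr
    rw [one_div, inv_mul_le_iff₀ hK]
    exact hfin.trans (mul_le_mul_of_nonneg_right hnN hD)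

end Reduction

/-! ### ZZZX-3  The doors: [MCMC♮] from (RG-geo) (PROVED) -/

section Doors

/-- ★★★ **THE DOOR W2c WITH GRAPH RIGIDITY DISCHARGED TO GEOMETRY (PROVED)**: `[MCMC♮](ϑc) ⟸ (SC♮) ∧ (X1ᴸ)(lam > 0) ∧ (X2ᴸ) ∧ (RG-geo)(N₀, H₀, μ₀, Δ₀) ∧
(DWᴹ)(cE, σ₀)` with `σ₀ < cE·cR·10⁻⁴`, `cR = 1/(N₀·H₀²·(1 + 3Δ₀/μ₀)²)` — tree ZZZWB's W2c⁺ door with `hRG := deficitRigidityP_of_coreFrameTree`. [this file, g89] -/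
theorem mildCoherentMoatCorePG_W2c_of_frameTree {ϑc sb₁ dI₁ dB₁ lam cE σ₀ μ₀ Δ₀ : ℝ} {N₀ H₀ : ℕ} (hlam : 0 < lam) (hcE : 0 ≤ cE) (hN : 0 < N₀)
    (hH : 0 < H₀) (hμ : 0 < μ₀) (hΔ : 0 ≤ Δ₀)
    (hgap : σ₀ < cE * (1 / ((N₀ : ℝ) * (H₀ : ℝ) ^ 2 * (1 + 3 * Δ₀ / μ₀) ^ 2) * (1 / 10000))) (hsb : 4 * sb₁ ≤ 249 / 5000)
    (hdI : 4 * dI₁ ≤ 249 / 5000) (hdB : dB₁ ≤ 2 / 5) (hsb₀ : 0 ≤ sb₁) (hdI₀ : 0 ≤ dI₁) (hdB₀ : 0 ≤ dB₁)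
    (hSC : CoherentZoneShadowCrystalP ϑc (1 / 10) 8 4 12 16 (17 / 20) (1 / 10000) 5 (1 / 10000) 10 (43 / 2) 1 2 (1 / 16) (1 / 50))
    (hX1 : LabelTubeConvexityP ϑc tameRadius (1 / 10) 8 (145 / 16) 4 12 16 16 (17 / 20) (1 / 10000) 5 (1 / 10000) 10 (43 / 2) (1 / 5000) (121 / 25)
      (249 / 5000) (249 / 5000) (21 / 50) lam 1 2 (1 / 16) (1 / 50))
    (hX2 : LabelLoadedTubeAprioriP ϑc tameRadius (1 / 10) 8 (145 / 16) 4 12 16 16 (17 / 20) (1 / 10000) 5 (1 / 10000) 10 (43 / 2) (1 / 5000)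
      (121 / 25) (249 / 5000) (249 / 5000) (21 / 50) sb₁ dI₁ dB₁ 1 2 (1 / 16) (1 / 50))
    (hFT : CoreFrameTreeP ϑc (1 / 10) 8 (145 / 16) 4 12 16 16 (17 / 20) (1 / 10000) 5 (1 / 10000) 10 (43 / 2) (121 / 25) sb₁ dI₁ dB₁ (121 / 25)
      N₀ H₀ μ₀ Δ₀ 1 2 (1 / 16) (1 / 50))
    (hDW : DeficitWellMinP ϑc tameRadius (1 / 10) 8 (145 / 16) 4 12 16 16 (17 / 20) (1 / 10000) 5 (1 / 10000) 10 (43 / 2) (121 / 25) sb₁ dI₁ dB₁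
      (121 / 25) cE σ₀ 1 2 (1 / 16) (1 / 50)) :
    MildCoherentMoatCorePG ϑc tameRadius (1 / 10) 8 4 12 16 1 2 (1 / 16) (1 / 50) :=
  mildCoherentMoatCorePG_W2c_of_labelChain hlam (chainRigidityConst_pos hN hH hμ hΔ).le hcE hgap hsb hdI hdB hsb₀ hdI₀ hdB₀ hSC hX1 hX2
    (deficitRigidityP_of_coreFrameTree hN hH hμ hΔ hFT) hDW

/-- ★★★★ **THE DOOR OF RECORD AT THE EXACT WELL (PROVED) — `[MCMC♮](ϑc) ⟸ (SC♮) ∧ (X1ᴸ)(lam > 0) ∧ (X2ᴸ) ∧ (RG-geo)(N₀, H₀, μ₀, Δ₀) ∧ (DWᴹ)(cE, 0)`,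
`0 < cE`** (critic row 1586, SCOPE-RG ruling: `σ₀ := 0` of record): the side condition `0 < cE·cR·10⁻⁴` holds for the explicit `cR > 0` of the chain-Poincaré
glue, so NO rigidity constant appears among the hypotheses.  Residual leaves of the W2 line: (SC♮) [KINEMATIC · ATTACKABLE], (X1ᴸ)/(X2ᴸ) [ANALYTIC · HEAVY],
(RG-geo) [KINEMATIC · S-side · ATTACKABLE-S], (DWᴹ)(cE, 0) [ENERGETIC · exact well]. [this file, g89] -/
theorem mildCoherentMoatCorePG_W2c_exactWell {ϑc sb₁ dI₁ dB₁ lam cE μ₀ Δ₀ : ℝ} {N₀ H₀ : ℕ} (hlam : 0 < lam) (hcE : 0 < cE) (hN : 0 < N₀) (hH : 0 < H₀)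
    (hμ : 0 < μ₀) (hΔ : 0 ≤ Δ₀) (hsb : 4 * sb₁ ≤ 249 / 5000) (hdI : 4 * dI₁ ≤ 249 / 5000) (hdB : dB₁ ≤ 2 / 5) (hsb₀ : 0 ≤ sb₁) (hdI₀ : 0 ≤ dI₁)
    (hdB₀ : 0 ≤ dB₁)
    (hSC : CoherentZoneShadowCrystalP ϑc (1 / 10) 8 4 12 16 (17 / 20) (1 / 10000) 5 (1 / 10000) 10 (43 / 2) 1 2 (1 / 16) (1 / 50))
    (hX1 : LabelTubeConvexityP ϑc tameRadius (1 / 10) 8 (145 / 16) 4 12 16 16 (17 / 20) (1 / 10000) 5 (1 / 10000) 10 (43 / 2) (1 / 5000) (121 / 25)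
      (249 / 5000) (249 / 5000) (21 / 50) lam 1 2 (1 / 16) (1 / 50))
    (hX2 : LabelLoadedTubeAprioriP ϑc tameRadius (1 / 10) 8 (145 / 16) 4 12 16 16 (17 / 20) (1 / 10000) 5 (1 / 10000) 10 (43 / 2) (1 / 5000)
      (121 / 25) (249 / 5000) (249 / 5000) (21 / 50) sb₁ dI₁ dB₁ 1 2 (1 / 16) (1 / 50))
    (hFT : CoreFrameTreeP ϑc (1 / 10) 8 (145 / 16) 4 12 16 16 (17 / 20) (1 / 10000) 5 (1 / 10000) 10 (43 / 2) (121 / 25) sb₁ dI₁ dB₁ (121 / 25)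
      N₀ H₀ μ₀ Δ₀ 1 2 (1 / 16) (1 / 50))
    (hDW : DeficitWellMinP ϑc tameRadius (1 / 10) 8 (145 / 16) 4 12 16 16 (17 / 20) (1 / 10000) 5 (1 / 10000) 10 (43 / 2) (121 / 25) sb₁ dI₁ dB₁
      (121 / 25) cE 0 1 2 (1 / 16) (1 / 50)) :
    MildCoherentMoatCorePG ϑc tameRadius (1 / 10) 8 4 12 16 1 2 (1 / 16) (1 / 50) :=
  mildCoherentMoatCorePG_W2c_of_frameTree hlam hcE.le hN hH hμ hΔ (mul_pos hcE (mul_pos (chainRigidityConst_pos hN hH hμ hΔ) (by norm_num))) hsb hdI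
    hdB hsb₀ hdI₀ hdB₀ hSC hX1 hX2 hFT hDW

end Doors

end Summit.AtomisticToContinuum.Crystallization.Theorems.ChartedZeroExcessLayeredLatticeLiouville

end
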